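import Summits.BirchSwinnertonDyer.BirchSwinnertonDyer.Theorems.AdditiveBranchIMCGordTwoTwistedWanDefs
import Summits.BirchSwinnertonDyer.BirchSwinnertonDyer.Theorems.AdditiveBranchIMCGordTwoRankZeroOffCaseOneFieldSupplyR0Local
import HarnessLib

/-!
# Crux 19357 `GordTwoRankZeroOffCaseOne`, line `three_field_road` v39 — brick E3′: THE GENUS-CLASS FIELD TWO OF THE TWISTED ROAD, design D2
# (the twisted Wan prime SPLIT in `K''`) — TARGET SIGNATURES (LEAD g15; `sorry` bodies on purpose — this is a spec, not a proof)

WHAT THIS IS: the kernel-checked STATEMENTS the next seat (pen draft + stub seat, as for E2's `FieldSupplyTwoR0`) has to prove so that the [L] stub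
`stub_twistedWanChainR0` of v39 can be ported. Nothing here is registered; nothing is asserted (the two theorems are `sorry`). LeadReport23 §6/§7
explain the design: the construction `ThreeFieldRoadSupply.exists_auxTwist` / `exists_ramifiedClass_partner` / `exists_fieldTwo_gordTwo`
(FieldSupplyR0{Aux,Class,Local}) runs VERBATIM with `q :=` the twisted Wan prime, but puts `q*` INTO `d_{K''}`, which makes the partner `A ≅ E`
ADDITIVE at `q` — fine for the place analysis after a small widening, but `A` then has no Skinner–Urban prime on class-C/E rows. Design D2 keeps `q`
OUT of `d_{K''}` (so `q` SPLITS in `K''` and `A ≅ Wd` is MULTIPLICATIVE at `q`, with `v_q(Δ_A) = −v_q(j)` prime to `p` by `TwistedWanPrime`):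

* `exists_auxTwist_twisted` — the auxiliary twist `X' ≅ V^{(q*·T)}`, `T = δ·ℓ₀*` (`V ≅ E^{(p*)}` the good-ordinary partner, `d_K = q*·δ`, `ℓ₀` a free
  Dirichlet prime), with `w(X') = −1` — the sign now from the LEAD's engines on `V` (additive potentially multiplicative of twist type at `q`):
  `TwistRootNumberTwisted.rootNumber_quadraticTwist_eq_neg_of_potMult_nonsplit` (p796897; twist `≡ 1 (mod 8)`),
  `…_nonsplit_goodTwo` (p798091; `E` good at `2`, twist `≡ 1 (mod 4)`), and — STILL MISSING for `2 ∥ N_E ∧ p ≡ ±3 (mod 8)` — a variant for a twist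
  `≡ 5 (mod 8)` at a multiplicative `2` (`λ₂` flips). The prescriptions on `ℓ₀` are listed in the statement.
* `exists_fieldTwo_twisted` — FIELD TWO on the twisted road: `K''` imaginary quadratic with `d_{K''} = p*·ℓ₀*·d` (NO `q*`), `p ∣ d_{K''}`, every bad
  prime of `Wd` other than `p` SPLIT in `K''` (in particular `q`), a free ramified prime `ℓ₀`, and `A ≅ Wd^{(d_{K''})}` globally minimal of analytic
  rank `0`, good ordinary at `p`, `ρ̄_{A,p}` onto, MULTIPLICATIVE at `q` with `p ∤ v_q(Δ_A)`, `p ∤ ∏ c(A)`; clause (4) of `RamifiedKolyvaginField`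
  is VACUOUS off `p`. Inputs: Friedberg–Hoffstein's prescribed-splitting instance (a tree theorem modulo Hoffstein–Luo) and modularity, as for E2.

BSD is proved for no curve by any of this.
-/

set_option linter.dupNamespace false
set_option autoImplicit false

noncomputable section

open scoped Classical

open WeierstrassCurve NumberField IsDedekindDomain Rat.HeightOneSpectrum
  Literature.NumberTheory.EllipticCurves Literature.NumberTheory.EllipticCurves.ModularForms
  Literature.NumberTheory.EllipticCurves.Rank1Residual
  Summit.BirchSwinnertonDyer.Rank1Residual Summit.BirchSwinnertonDyer.Rank1Residual.Additive
  Summit.BirchSwinnertonDyer.BirchSwinnertonDyer.Theorems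

namespace Summit.BirchSwinnertonDyer.BirchSwinnertonDyer.Cruxes.GordTwoRankZeroOffCaseOne.FieldTwoTwistedSpec

open NumberTheorySymbols Summit.BirchSwinnertonDyer.BirchSwinnertonDyer.Theorems.TwistedWanRoad

variable (W : WeierstrassCurve ℚ) [W.IsElliptic] [W.IsGloballyMinimal] (p : ℕ) [hp : Fact p.Prime]
  {q : ℕ} [hq : Fact q.Prime] (K : Type) [Field K] [NumberField K]
  {Wd : WeierstrassCurve ℚ} [Wd.IsElliptic] [Wd.IsGloballyMinimal]

/-- **TARGET (Aux′) — the auxiliary twist of the twisted road, design D2.** For `(E, p)` on cell (G-ord, `e = 2`), `p ≥ 5`, `w(E) = +1`, `E` not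
additive at `2`, odd additive primes of twist type, a twisted Wan prime `q` (`TwistedWanPrime W p q`), the twisted road field `K`
(`TameRoadFieldTwisted W p q K`; `d_K = q*·δ`) and a bound `M₀`: the good-ordinary partner `V ≅ E^{(p*)}`, the genus factor `δ`, a free prime
`ℓ₀ ∉ {2, p, q}`, `ℓ₀ ∤ N_E M₀ δ`, with the prescriptions `J(ℓ₀*|r) = J(q*δ|r)·J(p*|r)⁰…` spelled as needed by Class′/Local′, and a globally minimal
`X' ≅ V^{(q*·δ·ℓ₀*)}` with `w(X') = −1`. (Exact list of prescriptions: `(p*·ℓ₀*) > 0`-sign for `d'' < 0`; `J(ℓ₀*|r) = J(p*|r)` at `q`, at the odd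
bad `r ∉ {p}` of `E` and at the primes of `δ` [clause (3) and `A ≅ E` there]; `J(ℓ₀*|p) = J(q*δ|p)` [`A` good ordinary at `p`]; the class of `q*δℓ₀*`
at `q` making `X'` non-split [engine]; `p*ℓ₀* ≡ 1 (mod 8)` when `2 ∣ N_E` [2 splits in `K''`].) [statement; `sorry` — to be proved by the next seat] -/
theorem exists_auxTwist_twisted
    (hmod : exists_isNewformOf) (hp5 : 5 ≤ p) (hw : W.rootNumber = 1) (hcell : N10.CellGordTwo W p)
    (htt : ∀ r : Nat.Primes, (r : ℕ) ≠ 2 → W.HasAdditiveReductionAt ((primesEquiv (R := ℤ)).symm r) →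
      ¬ (W.quadraticTwist (((-1 : ℤ) ^ ((r : ℕ) / 2) * r : ℤ) : ℚ)).HasAdditiveReductionAt ((primesEquiv (R := ℤ)).symm r))
    (h2 : ¬ W.HasAdditiveReductionAt ((primesEquiv (R := ℤ)).symm ⟨2, Nat.prime_two⟩))
    (hK : TameRoadFieldTwisted W p q K) (M₀ : ℕ) (hM₀ : M₀ ≠ 0) :
    ∃ (V : WeierstrassCurve ℚ) (_ : V.IsElliptic) (_ : V.IsGloballyMinimal) (C' : VariableChange ℚ)
      (δ : ℤ) (ℓ₀ : ℕ) (X : WeierstrassCurve ℚ) (_ : X.IsElliptic) (_ : X.IsGloballyMinimal) (CX : VariableChange ℚ),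
      C' • V.quadraticTwist ((-1 : ℚ) ^ (p / 2) * p) = W ∧ GoodOrd V p ∧
      W.conductorNorm ℤ = V.conductorNorm ℤ * p ^ 2 ∧
      NumberField.discr K = ((-1 : ℤ) ^ (q / 2) * q) * δ ∧ Squarefree δ ∧ ¬ (p : ℤ) ∣ δ ∧ δ ≠ 0 ∧
      ℓ₀.Prime ∧ ℓ₀ ≠ p ∧ ℓ₀ ≠ q ∧ ℓ₀ ≠ 2 ∧ ¬ ℓ₀ ∣ W.conductorNorm ℤ * M₀ ∧ ¬ (ℓ₀ : ℤ) ∣ δ ∧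
      ((-1 : ℤ) ^ (p / 2) * p) * ((-1 : ℤ) ^ (ℓ₀ / 2) * ℓ₀) > 0 ∧
      (2 ∣ W.conductorNorm ℤ → (((-1 : ℤ) ^ (p / 2) * p) * ((-1 : ℤ) ^ (ℓ₀ / 2) * ℓ₀)) % 8 = 1) ∧
      (∀ r : ℕ, r.Prime → r ∣ W.conductorNorm ℤ * M₀ → r ≠ 2 → r ≠ p →
        J((-1 : ℤ) ^ (ℓ₀ / 2) * ℓ₀ | r) = J((-1 : ℤ) ^ (p / 2) * p | r)) ∧
      J((-1 : ℤ) ^ (ℓ₀ / 2) * ℓ₀ | p) = J(((-1 : ℤ) ^ (q / 2) * q) * δ | p) ∧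
      CX • X = V.quadraticTwist ((((-1 : ℤ) ^ (q / 2) * q) * (δ * ((-1 : ℤ) ^ (ℓ₀ / 2) * ℓ₀)) : ℤ) : ℚ) ∧ X.rootNumber = -1 := by
  sorry

omit [Wd.IsGloballyMinimal] in
/-- **TARGET (Local′) — FIELD TWO ON THE TWISTED ROAD, design D2.** For `(E, p)` on cell (G-ord, `e = 2`) with `p ≥ 5`, `w(E) = +1`, `ρ̄` onto,
`p ∤ ∏ c(E)`, `E` not additive at `2`, odd additive primes of twist type, the twisted road field `K` at the twisted Wan prime `q` and a globally minimal
`Wd ≅ E^{(d_K)}`: a `p`-RAMIFIED field `K''` for `(Wd, A)` WITH `q` SPLIT, a free ramified prime, and a globally minimal `A ≅ Wd^{(d_{K''})}` of analytic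
rank `0`, good ordinary at `p`, `ρ̄_{A,p}` onto, multiplicative at `q` with `p ∤ v_q(Δ_A)`, and `p ∤ ∏ c(A)` — the conclusion SHAPE of
`ThreeFieldRoadSupply.exists_fieldTwo_gordTwo` (so the r0 kernel's field-2/field-3 steps apply unchanged).
[statement; `sorry` — to be proved by the next seat] [cite: FriedbergHoffstein1995, Thm. B] [cite: JetchevSkinnerWan2017, §7.4.1] -/
theorem exists_fieldTwo_twisted
    (hFH : friedbergHoffstein_exists_heegnerField_splitDivisors_twist_ne_zero)
    (hmod : exists_isNewformOf) (hL : hasEntireLFunction_rat)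
    (hp5 : 5 ≤ p) (hw : W.rootNumber = 1) (hcell : N10.CellGordTwo W p) (hsurj : Surj W p)
    (htam : ¬ p ∣ W.tamagawaProduct)
    (htt : ∀ r : Nat.Primes, (r : ℕ) ≠ 2 → W.HasAdditiveReductionAt ((primesEquiv (R := ℤ)).symm r) →
      ¬ (W.quadraticTwist (((-1 : ℤ) ^ ((r : ℕ) / 2) * r : ℤ) : ℚ)).HasAdditiveReductionAt ((primesEquiv (R := ℤ)).symm r))
    (h2 : ¬ W.HasAdditiveReductionAt ((primesEquiv (R := ℤ)).symm ⟨2, Nat.prime_two⟩))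
    (hK : TameRoadFieldTwisted W p q K)
    (Cd : VariableChange ℚ) (hWd : Cd • W.quadraticTwist (NumberField.discr K : ℚ) = Wd) :
    ∃ (K'' : Type) (_ : Field K'') (_ : NumberField K'')
      (A : WeierstrassCurve ℚ) (_ : A.IsElliptic) (_ : A.IsGloballyMinimal),
      (IsImaginaryQuadratic K'' ∧ (p : ℤ) ∣ NumberField.discr K'' ∧
        (∀ ℓ : ℕ, ℓ.Prime → ℓ ∣ Wd.conductorNorm ℤ → ¬ (ℓ : ℤ) ∣ NumberField.discr K'' →
          SatisfiesHeegnerHypothesis ℓ K'') ∧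
        (∀ ℓ : ℕ, (hℓ : ℓ.Prime) → ℓ ∣ Wd.conductorNorm ℤ → (ℓ : ℤ) ∣ NumberField.discr K'' → ℓ ≠ p →
          (haveI : Fact ℓ.Prime := ⟨hℓ⟩;
            A.HasMultiplicativeReductionAtPrime ℓ ∧ ¬ A.HasSplitMultiplicativeReductionAtPrime ℓ))) ∧
      (∃ ℓ : ℕ, ℓ.Prime ∧ (ℓ : ℤ) ∣ NumberField.discr K'' ∧ ℓ ≠ p ∧ ¬ ℓ ∣ Wd.conductorNorm ℤ) ∧
      (∃ C : VariableChange ℚ, C • Wd.quadraticTwist (NumberField.discr K'' : ℚ) = A) ∧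
      A.analyticRank = 0 ∧ GoodOrd A p ∧ Surj A p ∧
      (∃ ℓ : ℕ, ∃ _ : Fact ℓ.Prime, ℓ ≠ p ∧ A.HasMultiplicativeReductionAtPrime ℓ ∧
        ¬ p ∣ padicValInt ℓ A.minimalDiscriminantInt) ∧
      ¬ p ∣ A.tamagawaProduct := by
  sorry

end Summit.BirchSwinnertonDyer.BirchSwinnertonDyer.Cruxes.GordTwoRankZeroOffCaseOne.FieldTwoTwistedSpec

end
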